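import Summits.CriticalPhenomena.PercolationContinuityZ3.Theorems.PercNearOneGluingNoHeavyLowerTailApexTwoSumGlue
import HarnessLib

/-!
# `NoHeavyLowerTail` (stmt-CriticalPhenomena-4575) — 2-sums through the apex, part 2:
# the Boolean tables of the join/separation rules (glued three-point cells as bilinear forms in the arm cells)

Support file (prover prim-gen-kcluster gen 72; `--supports stmt-CriticalPhenomena-4575`).  No definitions, no
named facts, no sorries.

SETTING as in part 1 (`…ApexTwoSumGlue`): arms `DX ∋ b`, `DY ∋ c` glued along `{a, h}`.  ARM CELLS of the arm `X`
(instance `(a; b, h)`; the same for `Y` with `c` in place of `b`): with the atoms `α = [b ∈ C(a)]`, `β = [h ∈ C(a)]`,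
`δ = [h ∈ C(b)]` (an equivalence relation on `{a, h, b}`) and the flag `ν = [C(a) meets every b–h path of DX]`,
`A = α ∧ β` (all joined), `B = ¬α ∧ β` (`a ~ h` only), `C = α ∧ ¬β` (`a ~ b` only), `D = ¬α ∧ ¬β ∧ δ` (`h ~ b` only),
`E = ¬α ∧ ¬β ∧ ¬δ` (apart), `N = ¬α ∧ ¬β ∧ ν` (apart and separated).  By the join rules of part 1 the glued atoms are
`[b ∈ C(a)] = α_X ∨ (δ_X ∧ (β_X ∨ β_Y))`, `[c ∈ C(a)] = α_Y ∨ (δ_Y ∧ (β_X ∨ β_Y))`, `[h ∈ C(a)] = β_X ∨ β_Y`, and the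
separation flag of the glued graph is `(β_X ∨ β_Y) ∨ ν_X ∨ ν_Y`; the free count exceeds the `{a,h}`-wired count by
`r = [h ∉ C(a)]` factors of `q`.  The four TABLES below give, for the cells `T = {b, c ∈ C(a)}`, `U_b`, `U_c` and
`S = {b, c ∉ C(a), separated}` of the glued instance `(a; b, c)`, the product (indicator × `q^{[h ∉ C(a)]}`) as a
bilinear form in the arm-cell indicators — the pointwise content of the dictionary of part 3
(validated numerically first: HOME/code/gen72/twosum_wired_check.py, 59 glued instances, q ∈ {1/2,1,2,7/2}, exact).
-/

namespace Summit.CriticalPhenomena.PercolationContinuityZ3.Theorems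

namespace ApexTwoSum

section Tables

variable {αX βX δX νX αY βY δY νY : Prop} {x r q aX bX cX dX eX nX aY bY cY dY eY nY : ℝ}

/-- **Table of the cell `T = {b, c ∈ C(a)}`** of the glued graph:
`1_T · q^{[h ∉ C(a)]} = a_X (a_Y + c_Y + d_Y) + c_X a_Y + q c_X c_Y + d_X a_Y`. [this work] -/
theorem table_T (t1X : αX → βX → δX) (t2X : αX → δX → βX) (t3X : βX → δX → αX)
    (t1Y : αY → βY → δY) (t2Y : αY → δY → βY) (t3Y : βY → δY → αY)
    (hr1 : (βX ∨ βY) → r = 1) (hrq : ¬ (βX ∨ βY) → r = q)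
    (hx1 : ((αX ∨ (δX ∧ (βX ∨ βY))) ∧ (αY ∨ (δY ∧ (βX ∨ βY)))) → x = 1)
    (hx0 : ¬ ((αX ∨ (δX ∧ (βX ∨ βY))) ∧ (αY ∨ (δY ∧ (βX ∨ βY)))) → x = 0)
    (haX1 : (αX ∧ βX) → aX = 1) (haX0 : ¬ (αX ∧ βX) → aX = 0)
    (hcX1 : (αX ∧ ¬βX) → cX = 1) (hcX0 : ¬ (αX ∧ ¬βX) → cX = 0)
    (hdX1 : (¬αX ∧ ¬βX ∧ δX) → dX = 1) (hdX0 : ¬ (¬αX ∧ ¬βX ∧ δX) → dX = 0)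
    (haY1 : (αY ∧ βY) → aY = 1) (haY0 : ¬ (αY ∧ βY) → aY = 0)
    (hcY1 : (αY ∧ ¬βY) → cY = 1) (hcY0 : ¬ (αY ∧ ¬βY) → cY = 0)
    (hdY1 : (¬αY ∧ ¬βY ∧ δY) → dY = 1) (hdY0 : ¬ (¬αY ∧ ¬βY ∧ δY) → dY = 0) :
    x * r = aX * (aY + cY + dY) + cX * aY + q * cX * cY + dX * aY := by
  by_cases hαX : αX <;> by_cases hβX : βX <;> by_cases hδX : δX <;>
    by_cases hαY : αY <;> by_cases hβY : βY <;> by_cases hδY : δY <;> simp_all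

/-- **Table of the cell `U_b = {b ∈ C(a), c ∉ C(a)}`**:
`1_{U_b} · q^{[h ∉ C(a)]} = a_X (b_Y + e_Y) + c_X b_Y + q c_X (d_Y + e_Y) + d_X b_Y`. [this work] -/
theorem table_Ub (t1X : αX → βX → δX) (t2X : αX → δX → βX) (t3X : βX → δX → αX)
    (t1Y : αY → βY → δY) (t2Y : αY → δY → βY) (t3Y : βY → δY → αY)
    (hr1 : (βX ∨ βY) → r = 1) (hrq : ¬ (βX ∨ βY) → r = q)
    (hx1 : ((αX ∨ (δX ∧ (βX ∨ βY))) ∧ ¬ (αY ∨ (δY ∧ (βX ∨ βY)))) → x = 1)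
    (hx0 : ¬ ((αX ∨ (δX ∧ (βX ∨ βY))) ∧ ¬ (αY ∨ (δY ∧ (βX ∨ βY)))) → x = 0)
    (haX1 : (αX ∧ βX) → aX = 1) (haX0 : ¬ (αX ∧ βX) → aX = 0)
    (hcX1 : (αX ∧ ¬βX) → cX = 1) (hcX0 : ¬ (αX ∧ ¬βX) → cX = 0)
    (hdX1 : (¬αX ∧ ¬βX ∧ δX) → dX = 1) (hdX0 : ¬ (¬αX ∧ ¬βX ∧ δX) → dX = 0)
    (hbY1 : (¬αY ∧ βY) → bY = 1) (hbY0 : ¬ (¬αY ∧ βY) → bY = 0)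
    (hdY1 : (¬αY ∧ ¬βY ∧ δY) → dY = 1) (hdY0 : ¬ (¬αY ∧ ¬βY ∧ δY) → dY = 0)
    (heY1 : (¬αY ∧ ¬βY ∧ ¬δY) → eY = 1) (heY0 : ¬ (¬αY ∧ ¬βY ∧ ¬δY) → eY = 0) :
    x * r = aX * (bY + eY) + cX * bY + q * cX * (dY + eY) + dX * bY := by
  by_cases hαX : αX <;> by_cases hβX : βX <;> by_cases hδX : δX <;>
    by_cases hαY : αY <;> by_cases hβY : βY <;> by_cases hδY : δY <;> simp_all

/-- **Table of the cell `U_c = {b ∉ C(a), c ∈ C(a)}`** (mirror of `table_Ub`):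
`1_{U_c} · q^{[h ∉ C(a)]} = a_Y (b_X + e_X) + c_Y b_X + q c_Y (d_X + e_X) + d_Y b_X`. [this work] -/
theorem table_Uc (t1X : αX → βX → δX) (t2X : αX → δX → βX) (t3X : βX → δX → αX)
    (t1Y : αY → βY → δY) (t2Y : αY → δY → βY) (t3Y : βY → δY → αY)
    (hr1 : (βX ∨ βY) → r = 1) (hrq : ¬ (βX ∨ βY) → r = q)
    (hx1 : (¬ (αX ∨ (δX ∧ (βX ∨ βY))) ∧ (αY ∨ (δY ∧ (βX ∨ βY)))) → x = 1)
    (hx0 : ¬ (¬ (αX ∨ (δX ∧ (βX ∨ βY))) ∧ (αY ∨ (δY ∧ (βX ∨ βY)))) → x = 0)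
    (hbX1 : (¬αX ∧ βX) → bX = 1) (hbX0 : ¬ (¬αX ∧ βX) → bX = 0)
    (hdX1 : (¬αX ∧ ¬βX ∧ δX) → dX = 1) (hdX0 : ¬ (¬αX ∧ ¬βX ∧ δX) → dX = 0)
    (heX1 : (¬αX ∧ ¬βX ∧ ¬δX) → eX = 1) (heX0 : ¬ (¬αX ∧ ¬βX ∧ ¬δX) → eX = 0)
    (haY1 : (αY ∧ βY) → aY = 1) (haY0 : ¬ (αY ∧ βY) → aY = 0)
    (hcY1 : (αY ∧ ¬βY) → cY = 1) (hcY0 : ¬ (αY ∧ ¬βY) → cY = 0)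
    (hdY1 : (¬αY ∧ ¬βY ∧ δY) → dY = 1) (hdY0 : ¬ (¬αY ∧ ¬βY ∧ δY) → dY = 0) :
    x * r = aY * (bX + eX) + cY * bX + q * cY * (dX + eX) + dY * bX := by
  by_cases hαX : αX <;> by_cases hβX : βX <;> by_cases hδX : δX <;>
    by_cases hαY : αY <;> by_cases hβY : βY <;> by_cases hδY : δY <;> simp_all

/-- **Table of the separating cell `S = {b, c ∉ C(a), C(a) meets every b–c path}`**: with the separation flag of
the glued graph `(β_X ∨ β_Y) ∨ ν_X ∨ ν_Y` (part 1) and `n = 1[¬α ∧ ¬β ∧ ν]`,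
`1_S · q^{[h ∉ C(a)]} = b_X b_Y + b_X e_Y + e_X b_Y + q (n_X (d_Y + e_Y) + (d_X + e_X) n_Y − n_X n_Y)`. [this work] -/
theorem table_S (t1X : αX → βX → δX) (t2X : αX → δX → βX) (t3X : βX → δX → αX)
    (t1Y : αY → βY → δY) (t2Y : αY → δY → βY) (t3Y : βY → δY → αY)
    (hr1 : (βX ∨ βY) → r = 1) (hrq : ¬ (βX ∨ βY) → r = q)
    (hx1 : (¬ (αX ∨ (δX ∧ (βX ∨ βY))) ∧ ¬ (αY ∨ (δY ∧ (βX ∨ βY))) ∧ ((βX ∨ βY) ∨ (νX ∨ νY))) → x = 1)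
    (hx0 : ¬ (¬ (αX ∨ (δX ∧ (βX ∨ βY))) ∧ ¬ (αY ∨ (δY ∧ (βX ∨ βY))) ∧ ((βX ∨ βY) ∨ (νX ∨ νY))) → x = 0)
    (hbX1 : (¬αX ∧ βX) → bX = 1) (hbX0 : ¬ (¬αX ∧ βX) → bX = 0)
    (hdX1 : (¬αX ∧ ¬βX ∧ δX) → dX = 1) (hdX0 : ¬ (¬αX ∧ ¬βX ∧ δX) → dX = 0)
    (heX1 : (¬αX ∧ ¬βX ∧ ¬δX) → eX = 1) (heX0 : ¬ (¬αX ∧ ¬βX ∧ ¬δX) → eX = 0)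
    (hnX1 : (¬αX ∧ ¬βX ∧ νX) → nX = 1) (hnX0 : ¬ (¬αX ∧ ¬βX ∧ νX) → nX = 0)
    (hbY1 : (¬αY ∧ βY) → bY = 1) (hbY0 : ¬ (¬αY ∧ βY) → bY = 0)
    (hdY1 : (¬αY ∧ ¬βY ∧ δY) → dY = 1) (hdY0 : ¬ (¬αY ∧ ¬βY ∧ δY) → dY = 0)
    (heY1 : (¬αY ∧ ¬βY ∧ ¬δY) → eY = 1) (heY0 : ¬ (¬αY ∧ ¬βY ∧ ¬δY) → eY = 0)
    (hnY1 : (¬αY ∧ ¬βY ∧ νY) → nY = 1) (hnY0 : ¬ (¬αY ∧ ¬βY ∧ νY) → nY = 0) :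
    x * r = bX * bY + bX * eY + eX * bY + q * (nX * (dY + eY) + (dX + eX) * nY - nX * nY) := by
  by_cases hαX : αX <;> by_cases hβX : βX <;> by_cases hδX : δX <;> by_cases hνX : νX <;>
    by_cases hαY : αY <;> by_cases hβY : βY <;> by_cases hδY : δY <;> by_cases hνY : νY <;> simp_all

end Tables

end ApexTwoSum

end Summit.CriticalPhenomena.PercolationContinuityZ3.Theorems
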